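import Literature.AlgebraicGeometry.Frobenioids.DivisorialDescriptions
import Literature.AlgebraicGeometry.Frobenioids.IsotropicFrobeniusTrivial
import HarnessLib

/-!
# Frobenioids I, Theorem 5.1 (iii): the category `C^Fr-tr` — dictionary, isomorphisms, pull-backs,
# pre-Frobenioid structure (abc-iut cell, layer L1, node D-η-3)

Mochizuki, *The geometry of Frobenioids I: the general theory*, Kyushu J. Math. **62** (2008)
293–400, §5, Theorem 5.1 (iii), kurims text p. 97, proof p. 99 [cite: MochizukiFrdI2008, Thm. 5.1 (iii) p.97]:

> "(iii) The subcategory `C^Fr-tr ⊆ C` determined by the Frobenius-trivial objects and isometric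
> morphisms is a Frobenioid of isotropic, group-like, base-trivial, and `Aut`-ample type. In
> particular, the isomorphism class of a Frobenius-trivial object of `C` is completely determined
> by the isomorphism class of its projection to `D`; all Frobenius-trivial objects of `C` are
> `Aut`-ample."

For the category `FrTr F = C^Fr-tr` and its structure functor `frTrFunctor F : C^Fr-tr → F_{0_D}`
(`DivisorialDescriptions.lean`) we record: the dictionary with `C → F_Φ`; isomorphisms of
`C^Fr-tr` are the isomorphisms of `C` between Frobenius-trivial objects; pre-steps of `C^Fr-tr` are
isomorphisms (isotropic type), so every object is isotropic and every arrow co-angular; morphisms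
of Frobenius type / pull-back morphisms of `C^Fr-tr` are exactly those of `C` lying in `C^Fr-tr`
(the latter via the factorisation "isometry = pull-back ∘ Frobenius type"); the objects of `C^Fr-tr`
are Frobenius-trivial in `C^Fr-tr`; the zero monoid `0_D` (`zeroMonoid D`, RULING C6) is a divisorial monoid on `D`; `C^Fr-tr`
is totally epimorphic, and connected GIVEN the "In particular" clause (base-isomorphic
Frobenius-trivial objects are isomorphic), which the text obtains from Thm. 5.1 (i). The clauses of
Def. 1.3 and the theorem are in `FrTrIsFrobenioid.lean`. No statement of the paper is strengthened.
-/

noncomputable section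

namespace Literature.AlgebraicGeometry.Frobenioids

open CategoryTheory Opposite

universe w v v' u u'

/-! ### The zero monoid `0_D` is a divisorial monoid on `D` -/

section ZeroMonoid

variable {D : Type u} [Category.{v} D]

/-- `0_D` is a monoid on `D` (Def. 1.1 (ii)): all pull-back maps are bijections of one-element sets.
[cite: MochizukiFrdI2008, Prop. 4.4 (i) p.83] -/
theorem isMonoidOn_zeroMonoid : IsMonoidOn (zeroMonoid.{w} D) where
  isCharInjective := fun _ =>
    ⟨fun a b _ => Subsingleton.elim a b, fun a b _ => by
      obtain ⟨a, rfl⟩ := Associates.mk_surjective a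
      obtain ⟨b, rfl⟩ := Associates.mk_surjective b
      rw [Subsingleton.elim a b]⟩
  bijective_of_isFSM := fun _ _ => ⟨fun a b _ => Subsingleton.elim a b, fun b => ⟨1, Subsingleton.elim _ b⟩⟩

/-- Over a one-element monoid the groupification is trivial. [cite: MochizukiFrdI2008, Prop. 4.4 (i) p.83] -/
private theorem gp_eq_one_of_subsingleton {M : Type w} [CommMonoid M] [Subsingleton M]
    (x : Algebra.GrothendieckGroup M) : x = 1 := by
  induction x using Localization.induction_on with
  | H p =>
    have h : Localization.mk p.1 p.2 * Algebra.GrothendieckGroup.of (p.2 : M) =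
        Algebra.GrothendieckGroup.of p.1 := by
      rw [Localization.mk_eq_monoidOf_mk'_apply]
      exact Submonoid.LocalizationMap.mk'_spec _ p.1 p.2
    have h1 : Algebra.GrothendieckGroup.of (p.2 : M) = 1 := by
      rw [Subsingleton.elim (p.2 : M) 1, map_one]
    have h2 : Algebra.GrothendieckGroup.of p.1 = 1 := by
      rw [Subsingleton.elim p.1 1, map_one]
    rw [h1, h2, mul_one] at h
    exact h

/-- `0_D` is divisorial (Def. 1.1 (i): the one-element monoid is integral, saturated, of
characteristic type and sharp). [cite: MochizukiFrdI2008, Prop. 4.4 (i) p.83] -/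
theorem isDivisorial_zeroMonoid : Objectwise (fun M _ => IsDivisorial M) (zeroMonoid.{w} D) :=
  fun _ =>
  ⟨⟨⟨fun a b _ => Subsingleton.elim a b⟩,
    ⟨fun x _ _ _ => ⟨1, by rw [map_one, gp_eq_one_of_subsingleton x]⟩⟩,
    ⟨fun u _ _ => Units.ext (Subsingleton.elim _ _)⟩⟩,
    ⟨fun a _ => Subsingleton.elim a 1⟩⟩

end ZeroMonoid

namespace PreFrobenioid

variable {D : Type u} [Category.{v} D] {Φ : Dᵒᵖ ⥤ CommMonCat.{w}}
  {C : Type u'} [Category.{v'} C] {F : C ⥤ ElemFrobenioid Φ}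

/-! ### Conjugation of `O^▷` along an isomorphism (any pre-Frobenioid) -/

variable (F) in
/-- Conjugation by an isomorphism `e : A ⥲ B` maps `O^▷(A)` into `O^▷(B)`.
[cite: MochizukiFrdI2008, Def. 1.3 (iii)(c) p.24] -/
theorem endConj_mem {A B : C} (e : A ≅ B) {a : End A} (ha : a ∈ endSubmonoid F A) :
    endConj e a ∈ endSubmonoid F B := by
  obtain ⟨hb, hl⟩ := ha
  have hb' : Base F (show A ⟶ A from a) = 𝟙 _ := hb
  have hl' : degFr F (show A ⟶ A from a) = 1 := hl
  refine ⟨?_, ?_⟩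
  · show Base F (e.inv ≫ (show A ⟶ A from a) ≫ e.hom) = 𝟙 _
    rw [base_comp, base_comp, hb', Category.id_comp, ← base_comp, e.inv_hom_id, base_id]
  · show degFr F (e.inv ≫ (show A ⟶ A from a) ≫ e.hom) = 1
    rw [degFr_comp, degFr_comp, hl', show degFr F e.inv = 1 from isLinear_of_isIso F e.inv,
      show degFr F e.hom = 1 from isLinear_of_isIso F e.hom, one_mul, one_mul]

variable (F) in
/-- `O^▷(A) ≃ O^▷(B)` by conjugation along an isomorphism `e : A ⥲ B`.
[cite: MochizukiFrdI2008, Def. 1.3 (iii)(c) p.24] -/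
def endSubmonoidConj {A B : C} (e : A ≅ B) : endSubmonoid F A ≃* endSubmonoid F B where
  toFun a := ⟨endConj e a.1, endConj_mem F e a.2⟩
  invFun b := ⟨endConj e.symm b.1, endConj_mem F e.symm b.2⟩
  left_inv a := Subtype.ext (by
    show e.symm.inv ≫ (e.inv ≫ (show A ⟶ A from a.1) ≫ e.hom) ≫ e.symm.hom = (show A ⟶ A from a.1)
    simp only [Iso.symm_inv, Iso.symm_hom, Category.assoc, Iso.hom_inv_id_assoc, Iso.hom_inv_id,
      Category.comp_id])
  right_inv b := Subtype.ext (by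
    show e.inv ≫ (e.symm.inv ≫ (show B ⟶ B from b.1) ≫ e.symm.hom) ≫ e.hom = (show B ⟶ B from b.1)
    simp only [Iso.symm_inv, Iso.symm_hom, Category.assoc, Iso.inv_hom_id_assoc, Iso.inv_hom_id,
      Category.comp_id])
  map_mul' a b := Subtype.ext ((endConj e).map_mul a.1 b.1)

/-- The conjugate commutes with `e`: `e ∘ (e⁻¹ a e)`… i.e. `e.hom ≫ conj(a) = a ≫ e.hom`.
[cite: MochizukiFrdI2008, Def. 1.3 (iii)(c) p.24] -/
theorem hom_comp_endSubmonoidConj {A B : C} (e : A ≅ B) (a : endSubmonoid F A) :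
    e.hom ≫ (show B ⟶ B from (endSubmonoidConj F e a).1) = (show A ⟶ A from a.1) ≫ e.hom := by
  show e.hom ≫ e.inv ≫ (show A ⟶ A from a.1) ≫ e.hom = (show A ⟶ A from a.1) ≫ e.hom
  rw [e.hom_inv_id_assoc]

namespace FrTr

/-! ### Dictionary for `C^Fr-tr → F_{0_D}` -/

/-- `Base` for `C^Fr-tr → F_{0_D}` is `Base` in `C`. [cite: MochizukiFrdI2008, Thm. 5.1 (iii) p.97] -/
theorem base_eq {A B : FrTr F} (φ : A ⟶ B) : Base (frTrFunctor F) φ = Base F φ.1 := rfl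

/-- `deg_Fr` for `C^Fr-tr → F_{0_D}` is `deg_Fr` in `C`. [cite: MochizukiFrdI2008, Thm. 5.1 (iii) p.97] -/
theorem degFr_eq {A B : FrTr F} (φ : A ⟶ B) : degFr (frTrFunctor F) φ = degFr F φ.1 := rfl

/-- The base object of `A ∈ Ob(C^Fr-tr)` is that of `A ∈ Ob(C)`. [cite: MochizukiFrdI2008, Thm. 5.1 (iii) p.97] -/
theorem baseObj_eq (A : FrTr F) : baseObj (frTrFunctor F) A = baseObj F A.1 := rfl

/-- Every arrow of `C^Fr-tr` is an isometry for `C^Fr-tr → F_{0_D}` (all divisors vanish in `0_D`).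
[cite: MochizukiFrdI2008, Thm. 5.1 (iii) p.97] -/
theorem isIsometry {A B : FrTr F} (φ : A ⟶ B) : IsIsometry (frTrFunctor F) φ := rfl

/-- Linear in `C^Fr-tr` iff linear in `C`. [cite: MochizukiFrdI2008, Thm. 5.1 (iii) p.97] -/
theorem isLinear_iff {A B : FrTr F} (φ : A ⟶ B) : IsLinear (frTrFunctor F) φ ↔ IsLinear F φ.1 := Iff.rfl

/-- Pre-step in `C^Fr-tr` iff pre-step in `C`. [cite: MochizukiFrdI2008, Thm. 5.1 (iii) p.97] -/
theorem isPreStep_iff {A B : FrTr F} (φ : A ⟶ B) : IsPreStep (frTrFunctor F) φ ↔ IsPreStep F φ.1 :=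
  Iff.rfl

/-! ### Isomorphisms of `C^Fr-tr` -/

/-- An isomorphism of `C` between Frobenius-trivial objects is an isomorphism of `C^Fr-tr`
(isomorphisms are isometries). [cite: MochizukiFrdI2008, Thm. 5.1 (iii) p.97] -/
def isoMk (hP : IsPreFrobenioid Φ F) {A B : FrTr F} (e : A.1 ≅ B.1) : A ≅ B where
  hom := ⟨e.hom, isIsometry_of_isIso F hP e.hom⟩
  inv := ⟨e.inv, isIsometry_of_isIso F hP e.inv⟩
  hom_inv_id := Subtype.ext e.hom_inv_id
  inv_hom_id := Subtype.ext e.inv_hom_id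

/-- A morphism of `C^Fr-tr` invertible in `C` is invertible in `C^Fr-tr`. [cite: MochizukiFrdI2008, Thm. 5.1 (iii) p.97] -/
theorem isIso_of_isIso_val (hP : IsPreFrobenioid Φ F) {A B : FrTr F} (φ : A ⟶ B) [IsIso φ.1] : IsIso φ :=
  ⟨⟨(isoMk hP (asIso φ.1)).inv, Subtype.ext (IsIso.hom_inv_id φ.1), Subtype.ext (IsIso.inv_hom_id φ.1)⟩⟩

/-- An isomorphism of `C^Fr-tr` is an isomorphism of `C`. [cite: MochizukiFrdI2008, Thm. 5.1 (iii) p.97] -/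
theorem isIso_val {A B : FrTr F} (φ : A ⟶ B) [IsIso φ] : IsIso φ.1 :=
  (inferInstance : IsIso ((FrTr.ι F).map φ))

/-- A pre-step of `C^Fr-tr` is an isomorphism (`C` of isotropic type: isometric pre-steps are
invertible). [cite: MochizukiFrdI2008, Thm. 5.1 (iii) p.99] -/
theorem isIso_of_isPreStep (hF : IsFrobenioid F) (hiso : IsOfIsotropicType F) {A B : FrTr F} (φ : A ⟶ B)
    (h : IsPreStep (frTrFunctor F) φ) : IsIso φ :=
  haveI : IsIso φ.1 := hiso A.1 φ.1 φ.2 h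
  isIso_of_isIso_val hF.isPreFrobenioid φ

/-- Every object of `C^Fr-tr` is isotropic. [cite: MochizukiFrdI2008, Thm. 5.1 (iii) p.97] -/
theorem isIsotropic (hF : IsFrobenioid F) (hiso : IsOfIsotropicType F) (A : FrTr F) :
    IsIsotropic (frTrFunctor F) A :=
  fun _ ψ _ h => isIso_of_isPreStep hF hiso ψ h

/-- Every arrow of `C^Fr-tr` is co-angular. [cite: MochizukiFrdI2008, Thm. 5.1 (iii) p.99] -/
theorem isCoAngular (hF : IsFrobenioid F) (hiso : IsOfIsotropicType F) {A B : FrTr F} (φ : A ⟶ B) :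
    IsCoAngular (frTrFunctor F) φ :=
  fun _ _ _ β _ _ _ _ h _ => isIso_of_isPreStep hF hiso β h

/-- Frobenius type in `C^Fr-tr` iff Frobenius type in `C`. [cite: MochizukiFrdI2008, Thm. 5.1 (iii) p.99] -/
theorem isFrobeniusType_iff (hF : IsFrobenioid F) (hiso : IsOfIsotropicType F) {A B : FrTr F} (φ : A ⟶ B) :
    IsFrobeniusType (frTrFunctor F) φ ↔ IsFrobeniusType F φ.1 :=
  ⟨fun h => (isFrobeniusType_iff_of_isOfIsotropicType F hiso φ.1).2 ⟨φ.2, h.2⟩,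
    fun h => ⟨⟨isCoAngular hF hiso φ, rfl⟩, h.2⟩⟩

/-- Identities and isomorphisms of `C^Fr-tr` are pre-steps. [cite: MochizukiFrdI2008, Thm. 5.1 (iii) p.97] -/
theorem isPreStep_of_isIso {A B : FrTr F} (φ : A ⟶ B) [IsIso φ] : IsPreStep (frTrFunctor F) φ :=
  PreFrobenioid.isPreStep_of_isIso (frTrFunctor F) φ

/-! ### Pull-back morphisms of `C^Fr-tr` -/

/-- In `N_{≥1}`, `m n = 1` forces `n = 1`. [cite: MochizukiFrdI2008, §0 p.10] -/
private theorem pnat_eq_one_of_mul_eq_one_left {m n : ℕ+} (h : m * n = 1) : n = 1 :=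
  PNat.eq (by
    rw [PNat.one_coe]
    exact Nat.eq_one_of_mul_eq_one_left (by rw [← PNat.mul_coe, h, PNat.one_coe]))

/-- A pull-back morphism of `C` lying in `C^Fr-tr` is a pull-back morphism of `C^Fr-tr` (the unique
lift of an isometry along a linear isometry is an isometry). [cite: MochizukiFrdI2008, Thm. 5.1 (iii) p.99] -/
theorem isPullbackMorphism_of_val (hF : IsFrobenioid F) {A B : FrTr F} (φ : A ⟶ B)
    (h : IsPullbackMorphism F φ.1) : IsPullbackMorphism (frTrFunctor F) φ := by
  obtain ⟨⟨_, hφiso⟩, hφlin⟩ := hF.iv_b φ.1 h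
  have hφiso' : Div F φ.1 = 1 := hφiso
  have hφlin' : degFr F φ.1 = 1 := hφlin
  intro W
  constructor
  · intro γ γ' e
    have e1 : γ.1 ≫ φ.1 = γ'.1 ≫ φ.1 :=
      congrArg (fun p : PullbackHomData (frTrFunctor F) φ W => p.1.1.1) e
    have e2 : Base F γ.1 = Base F γ'.1 :=
      congrArg (fun p : PullbackHomData (frTrFunctor F) φ W => p.1.2) e
    exact Subtype.ext ((h W.1).1 (Subtype.ext (Prod.ext e1 e2)))
  · rintro ⟨⟨δ, ε⟩, hδ⟩
    have hδ' : Base F δ.1 = ε ≫ Base F φ.1 := hδ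
    obtain ⟨γ, hγ⟩ := (h W.1).2 ⟨(δ.1, ε), hδ'⟩
    have hγ1 : γ ≫ φ.1 = δ.1 := congrArg (fun p : PullbackHomData F φ.1 W.1 => p.1.1) hγ
    have hγ2 : Base F γ = ε := congrArg (fun p : PullbackHomData F φ.1 W.1 => p.1.2) hγ
    have hγiso : IsIsometry F γ := by
      have hd := congrArg (Div F) hγ1
      rw [div_comp, hφiso', map_one, one_mul, hφlin', PNat.one_coe, pow_one] at hd
      exact hd.trans δ.2
    exact ⟨⟨γ, hγiso⟩, Subtype.ext (Prod.ext (Subtype.ext hγ1) hγ2)⟩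

/-- A pull-back morphism of `C^Fr-tr` is a pull-back morphism of `C`: testing against the pull-back
factor of "isometry = pull-back ∘ Frobenius type" shows it is linear.
[cite: MochizukiFrdI2008, Thm. 5.1 (iii) p.99] -/
theorem isPullbackMorphism_val (hF : IsFrobenioid F) (hiso : IsOfIsotropicType F) {A B : FrTr F}
    (φ : A ⟶ B) (h : IsPullbackMorphism (frTrFunctor F) φ) : IsPullbackMorphism F φ.1 := by
  obtain ⟨Y, γ, α, hfac, hγ, hα, hY⟩ :=
    exists_frobeniusType_pullback_of_isIsometry' F hF hiso A.2 φ.1 φ.2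
  obtain ⟨⟨_, hαiso⟩, hαlin⟩ := hF.iv_b α hα
  have hαlin' : degFr F α = 1 := hαlin
  haveI : IsIso (Base F γ) := hγ.2
  let W : FrTr F := ⟨Y, hY⟩
  let δ : W ⟶ B := ⟨α, hαiso⟩
  let ε₀ := inv (Base F γ)
  let ε : baseObj (frTrFunctor F) W ⟶ baseObj (frTrFunctor F) A := ε₀
  have hcompat : Base (frTrFunctor F) δ = ε ≫ Base (frTrFunctor F) φ := by
    show Base F α = inv (Base F γ) ≫ Base F φ.1
    rw [← hfac, base_comp, IsIso.inv_hom_id_assoc]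
  obtain ⟨g, hg⟩ := (h W).2 ⟨(δ, ε), hcompat⟩
  have hg1 : g.1 ≫ φ.1 = α := congrArg (fun p : PullbackHomData (frTrFunctor F) φ W => p.1.1.1) hg
  have hdeg : degFr F g.1 * degFr F φ.1 = 1 := by
    have hd := congrArg (degFr F) hg1
    rw [degFr_comp, hαlin'] at hd
    exact hd
  exact (isPullbackMorphism_iff_of_isOfIsotropicType F hF hiso φ.1).2
    ⟨φ.2, pnat_eq_one_of_mul_eq_one_left hdeg⟩

/-- Pull-back morphism in `C^Fr-tr` iff pull-back morphism in `C`. [cite: MochizukiFrdI2008, Thm. 5.1 (iii) p.99] -/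
theorem isPullbackMorphism_iff (hF : IsFrobenioid F) (hiso : IsOfIsotropicType F) {A B : FrTr F} (φ : A ⟶ B) :
    IsPullbackMorphism (frTrFunctor F) φ ↔ IsPullbackMorphism F φ.1 :=
  ⟨isPullbackMorphism_val hF hiso φ, isPullbackMorphism_of_val hF φ⟩

/-! ### The objects of `C^Fr-tr` are Frobenius-trivial in `C^Fr-tr` -/

/-- The Frobenius endomorphisms `ζ_A(n)` of a Frobenius-trivial `A` are isometries, so `A` is
Frobenius-trivial as an object of `C^Fr-tr`. [cite: MochizukiFrdI2008, Thm. 5.1 (iii) p.99] -/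
theorem isFrobeniusTrivial (hF : IsFrobenioid F) (hiso : IsOfIsotropicType F) (A : FrTr F) :
    IsFrobeniusTrivial (frTrFunctor F) A := by
  obtain ⟨ζ, hζ⟩ := A.2
  let ζ' : ℕ+ →* End A :=
    { toFun := fun n => ⟨End.asHom (ζ n), (hζ n).2.2.1.2⟩
      map_one' := Subtype.ext (by
        show End.asHom (ζ 1) = 𝟙 A.1
        rw [map_one]
        rfl)
      map_mul' := fun m n => Subtype.ext (by
        show End.asHom (ζ (m * n)) = End.asHom (ζ n) ≫ End.asHom (ζ m)
        rw [map_mul]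
        rfl) }
  exact ⟨ζ', fun n => ⟨(hζ n).1, (hζ n).2.1, (isFrobeniusType_iff hF hiso _).2 (hζ n).2.2⟩⟩

/-! ### Pull-back morphisms over a given arrow of `D` -/

/-- Over an arrow `f : T → A_D` of `D`, `A ∈ Ob(C^Fr-tr)`, there is a pull-back morphism `X → A`
of `C` with `X` Frobenius-trivial and `X_D ≅ T` over `A_D` (Def. 1.3 (i)(c) for `C`, and
Frobenius-triviality of the domain of a pull-back morphism). [cite: MochizukiFrdI2008, Thm. 5.1 (iii) p.99] -/
theorem exists_pullback_over (hF : IsFrobenioid F) (hiso : IsOfIsotropicType F) (A : FrTr F) {T : D}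
    (f : T ⟶ baseObj F A.1) :
    ∃ (X : FrTr F) (ψ : X ⟶ A) (i : baseObj F X.1 ≅ T),
      IsPullbackMorphism F ψ.1 ∧ i.hom ≫ f = Base F ψ.1 := by
  haveI := hF.i_c A.1
  obtain ⟨P, ⟨e⟩⟩ := Functor.EssSurj.mem_essImage (pullbackSliceToBase F A.1) (Over.mk f)
  let i : baseObj F P.left.obj ≅ T := (Over.forget _).mapIso e
  have hw : i.hom ≫ f = Base F P.hom.1 := Over.w e.hom
  have hX : IsFrobeniusTrivial F P.left.obj :=
    IsFrobeniusTrivial.of_isPullbackMorphism F hF hiso P.hom.1 P.hom.2 A.2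
  obtain ⟨⟨_, hiso'⟩, _⟩ := hF.iv_b P.hom.1 P.hom.2
  exact ⟨⟨P.left.obj, hX⟩, ⟨P.hom.1, hiso'⟩, i, P.hom.2, hw⟩

/-! ### `C^Fr-tr` is totally epimorphic, and connected given the "In particular" clause -/

/-- `C^Fr-tr` is totally epimorphic (as `C` is). [cite: MochizukiFrdI2008, Thm. 5.1 (iii) p.99] -/
theorem isTotallyEpimorphic (hF : IsFrobenioid F) : IsTotallyEpimorphic (FrTr F) := by
  refine ⟨fun {A B} φ => ⟨fun {Z} g g' e => ?_⟩⟩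
  haveI := hF.isPreFrobenioid.isTotallyEpimorphic.epi φ.1
  have e' : φ.1 ≫ g.1 = φ.1 ≫ g'.1 := congrArg Subtype.val e
  exact Subtype.ext ((cancel_epi φ.1).mp e')

/-- One step of connectedness: an arrow `A_D → B_D` of `D` between the bases of objects of `C^Fr-tr`
yields a zigzag `A ≅ X → B` in `C^Fr-tr`, GIVEN that base-isomorphic Frobenius-trivial objects are
isomorphic. [cite: MochizukiFrdI2008, Thm. 5.1 (iii) p.99] -/
theorem zigzag_of_hom (hF : IsFrobenioid F) (hiso : IsOfIsotropicType F)
    (hK : ∀ A A' : C, IsFrobeniusTrivial F A → IsFrobeniusTrivial F A' → BaseIsomorphic F A A' →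
      Nonempty (A ≅ A'))
    (A B : FrTr F) (f : baseObj F A.1 ⟶ baseObj F B.1) : Zigzag A B := by
  obtain ⟨X, ψ, i, _, _⟩ := exists_pullback_over hF hiso B f
  obtain ⟨j⟩ := hK A.1 X.1 A.2 X.2 ⟨i.symm⟩
  exact (Zigzag.of_hom (isoMk hF.isPreFrobenioid j).hom).trans (Zigzag.of_hom ψ)

/-- `C^Fr-tr` is connected (`D` connected, Def. 1.3 (i)(a)), GIVEN that base-isomorphic
Frobenius-trivial objects are isomorphic. [cite: MochizukiFrdI2008, Thm. 5.1 (iii) p.99] -/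
theorem isGraphConnected (hF : IsFrobenioid F) (hiso : IsOfIsotropicType F)
    (hK : ∀ A A' : C, IsFrobeniusTrivial F A → IsFrobeniusTrivial F A' → BaseIsomorphic F A A' →
      Nonempty (A ≅ A')) : IsGraphConnected (FrTr F) := by
  obtain ⟨⟨P₀⟩, hz⟩ := hF.isPreFrobenioid.isGraphConnected_base
  have over : ∀ P : D, ∃ A : FrTr F, Nonempty (baseObj F A.1 ≅ P) := fun P => by
    obtain ⟨A, hA, ⟨e⟩⟩ := hF.i_a P
    exact ⟨⟨A, hA⟩, ⟨e⟩⟩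
  have main : ∀ (P Q : D), Zigzag P Q → ∀ (A B : FrTr F),
      (baseObj F A.1 ≅ P) → (baseObj F B.1 ≅ Q) → Zigzag A B := by
    intro P Q h
    induction h with
    | refl =>
      intro A B eA eB
      exact zigzag_of_hom hF hiso hK A B (eA.hom ≫ eB.inv)
    | @tail Q' Q _ hPQ ih =>
      intro A B eA eB
      obtain ⟨B', ⟨eB'⟩⟩ := over Q'
      refine (ih A B' eA eB').trans ?_
      rcases hPQ with hf | hg
      · obtain ⟨f⟩ := hf
        exact zigzag_of_hom hF hiso hK B' B (eB'.hom ≫ f ≫ eB.inv)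
      · obtain ⟨g⟩ := hg
        exact (zigzag_of_hom hF hiso hK B B' (eB.hom ≫ g ≫ eB'.inv)).symm
  obtain ⟨A₀, _⟩ := over P₀
  exact ⟨⟨A₀⟩, fun A B => main _ _ (hz _ _) A B (Iso.refl _) (Iso.refl _)⟩

/-- **Thm. 5.1 (iii), standing part**: `C^Fr-tr → F_{0_D}` is a pre-Frobenioid (Def. 1.1 (iv)),
GIVEN that base-isomorphic Frobenius-trivial objects of `C` are isomorphic.
[cite: MochizukiFrdI2008, Thm. 5.1 (iii) p.97] -/
theorem isPreFrobenioid (hF : IsFrobenioid F) (hiso : IsOfIsotropicType F)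
    (hK : ∀ A A' : C, IsFrobeniusTrivial F A → IsFrobeniusTrivial F A' → BaseIsomorphic F A A' →
      Nonempty (A ≅ A')) : IsPreFrobenioid (zeroMonoid.{w} D) (frTrFunctor F) where
  isMonoidOn := isMonoidOn_zeroMonoid
  isDivisorial := isDivisorial_zeroMonoid
  isGraphConnected_base := hF.isPreFrobenioid.isGraphConnected_base
  isTotallyEpimorphic_base := hF.isPreFrobenioid.isTotallyEpimorphic_base
  isGraphConnected := isGraphConnected hF hiso hK
  isTotallyEpimorphic := isTotallyEpimorphic hF

end FrTr

end PreFrobenioid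

end Literature.AlgebraicGeometry.Frobenioids
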